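import Summits.QuantumFields.BalabanUV.T4Continuum.Support.RegionLocalInjectedPairing

/-!
# T⁴ programme, spine node NE2 (U1a), sub-row Δ1 «NE2⁰-Dirichlet» — THE RESOLVENT-SPLIT REDUCTION OF KING's COMPRESSED INJECTED LAW ON AN
# ARBITRARY REGION CLASS: `hinjK` ⟸ (L) ∧ (B) ∧ (Bᵗ) ∧ (K) given only W1 (one coercivity constant of `Δ_a(Ω₀)` along the tower)
# (owner item O15-f «Δ1-VEC-W3-RESOLVENT-REGION», the first brick of the holed-region front)

Row NE2 OWNER (unit `b2b-balaban-t4-ne2-p1`, gen 15).  O15-a's tower junction `RegionGaugeResolventTower.hinjK_of_local` (p238533) and O15-b's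
`RegionLocalInjectedPairing.hloc_of_pairing` (p238678) take W1 from the owner's box theorem `sliceCoercive_lev_box`; everything else in them is
region-general (`opNorm_injected_le_of_local` holds for ANY region).  The NEXT FRONT of the row (ruling R37 (e), `t4/T4-EST-NE2-P1.md` §G15.0 (C))
is the tower on regions with re-entrant contact — the holed complements of [B9]'s Dirichlet holes — where W1 is ALREADY landed by leaf-09-g9
(«Δ1-VEC-W1-HOLED»: `sliceCoercive_holed` / `sliceCoercive_scattered`, one level-uniform constant).  THIS FILE states the two junctions with W1
as a DISPLAYED level-uniform coercivity constant, for every union of unit blocks `S`: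

 * **`hloc_of_pairing_of_coercive`** — leaf (L) from a commutator pairing of the LOCAL operator with budgets, given `∀ k, Coercive (Δ_a^{(k)}(Ω₀)) γ`;
 * **`hinjK_of_local_of_coercive`** — `hinjK` at rate θ from (L)(B)(Bᵗ)(K) with the constant `C1reg d a′ γ Cl Cb Cbt Ck` (O15-a's `C1loc` with
   `γ⋆` replaced by the displayed `γ`);
 * `hinjK_of_local_of_slice` — the same with W1 displayed as ONE slice constant `c` (`γ = gamStar d a′ c`), the shape leaf-09-g9's ENDs deliver.
What is NOT here (and is genuinely different off boxes, EST §G15.0 (C)): the four leaves themselves — on re-entrant regions `Δ_loc` is not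
componentwise (the exterior-flux block couples components at re-entrant exterior sites), interior W2 and the Hessian budgets grow with the level,
and the scalar two-level inputs behind (B)/(K) are the Besov-route ones; the tower END then comes from the COMPRESSED star tower
(`DirichletStarVectorTower.towerLimitRate_star_of_linear`, W2 in the linear class) rather than the renormalised one.

HONEST FRAMING (T4-DAG p. 1).  Bookkeeping over landed modules ([folklore]); model level (`U = 1`, ONE region, ONE averaging scale, finite torus,
linear layer, operator norm); W1 and the four leaves DISPLAYED; nothing proved about any particular region here; NE2 (U1a) NOT proved; spine
PROVED 0/9 unchanged; NOT [B9] (3.16)/(3.23)–(3.27)/(3.42) as printed; NOT infinite volume / mass gap / Clay.  HONEST DEPENDENCY: continuum YM on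
T⁴ ⇐ BetaPertH ∧ nine spine estimates (0/9 proved); BetaPertH ⇐ (D1) ∧ (D4) ∧ CAP+tail; G-an2-4 gates asym, D1 and NE2/3/4.  No `sorry`.
-/

noncomputable section

open scoped BigOperators ComplexConjugate Matrix Matrix.Norms.L2Operator

namespace Summit.QuantumFields.BalabanUV.T4Continuum.RegionGaugeResolventTowerRegion

open Literature.MathematicalPhysics.QuantumFieldTheory.Balaban1983to89.B5Prop11Plancherel (Tor fine)
open Literature.MathematicalPhysics.QuantumFieldTheory.Balaban1983to89.B5Prop11Lower (nsq)
open Literature.MathematicalPhysics.QuantumFieldTheory.Balaban1983to89.B5G183RateUnitTower (lev)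
open Summit.QuantumFields.BalabanUV.T4Continuum
open Summit.QuantumFields.BalabanUV.T4Continuum.SubtypeCompression (Coercive isUnit_det_of_coercive opNorm_inv_le_of_coercive)
open Summit.QuantumFields.BalabanUV.T4Continuum.ScalarAveragedPropagator (gammaPs)
open Summit.QuantumFields.BalabanUV.T4Continuum.ScalarAveragedCompression (sigma0)
open Summit.QuantumFields.BalabanUV.T4Continuum.RegionScalarCompression (KcompR)
open Summit.QuantumFields.BalabanUV.T4Continuum.RegionGaugeSlice (SliceCoercive)
open Summit.QuantumFields.BalabanUV.T4Continuum.RegionScalarCompression (QOm GOm)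
open Summit.QuantumFields.BalabanUV.T4Continuum.RegionGaugeFixedVector (starReg curlR gradR avgR regionDeltaA)
open Summit.QuantumFields.BalabanUV.T4Continuum.DirichletSubregionTowerOf (pidx JpR opNorm_JpR_le)
open Summit.QuantumFields.BalabanUV.T4Continuum.DirichletStarVectorTower (starP gamStar gamStar_pos coercive_regionDeltaA_of_slice)
open Summit.QuantumFields.BalabanUV.T4Continuum.RegionStarInjectedPairing (opNorm_injected_le_of_pairing)
open Summit.QuantumFields.BalabanUV.T4Continuum.RegionGaugeResolventSplit
open Summit.QuantumFields.BalabanUV.T4Continuum.RegionGaugeResolventTower (kap kap_nonneg gaugeErr opNorm_injected_le_of_local)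

variable {d : ℕ} (L : ℕ) [NeZero L] (M : Fin d → ℕ) [hM : ∀ μ, NeZero (M μ)] (S : Tor M → Prop) [DecidablePred S] (a a' : ℝ)

/-- the two-level constant of the faithful tower from the four leaf constants and a DISPLAYED coercivity constant `γ`. [folklore] -/
def C1reg (d : ℕ) (a' γ Cl Cb Cbt Ck : ℝ) : ℝ :=
  (1 + kap d a' γ) * Cl * (1 + kap d a' γ) + γ⁻¹ * gaugeErr d a' Cb Cbt Ck * γ⁻¹

/-- **LEAF (L) FROM (P̃) + (R̃) ON ANY REGION WITH W1** (`0 < a′`, `0 < γ`, `Δ_a^{(k)}(Ω₀)` γ-coercive at every level): pairing constants `ε_k`,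
budget bounds `Λ_k`, `Λ′_k` for the LOCAL propagators with `ε_kΛ_kΛ′_k ≤ Cl·θ^k` ⟹ `‖G̃_{k+1}·JpR k − JpR k·G̃_k‖ ≤ Cl·θ^k`. [folklore] -/
theorem hloc_of_pairing_of_coercive (ha' : 0 < a') {γ : ℝ} (hγ : 0 < γ) (hco : ∀ k, Coercive (regionDeltaA (lev L k) M a a' S) γ)
    {E : (k : ℕ) → (pidx L M (starP L M S) k → ℂ) → ℝ} {E' : (k : ℕ) → (pidx L M (starP L M S) (k + 1) → ℂ) → ℝ}
    {ε Λ Λ' : ℕ → ℝ} (hε : ∀ k, 0 ≤ ε k) (hΛ : ∀ k, 0 ≤ Λ k) (hΛ' : ∀ k, 0 ≤ Λ' k)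
    (hP : ∀ (k : ℕ) (u : pidx L M (starP L M S) k → ℂ) (v : pidx L M (starP L M S) (k + 1) → ℂ),
      ‖star v ⬝ᵥ ((JpR L M (starP L M S) k * regionDeltaLoc (lev L k) M a S
          - regionDeltaLoc (lev L (k + 1)) M a S * JpR L M (starP L M S) k) *ᵥ u)‖
        ≤ ε k * Real.sqrt (E k u) * Real.sqrt (E' k v))
    (hR : ∀ (k : ℕ) (f : pidx L M (starP L M S) k → ℂ),
      Real.sqrt (E k ((regionDeltaLoc (lev L k) M a S)⁻¹ *ᵥ f)) ≤ Λ k * Real.sqrt (nsq f))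
    (hR' : ∀ (k : ℕ) (g : pidx L M (starP L M S) (k + 1) → ℂ),
      Real.sqrt (E' k ((regionDeltaLoc (lev L (k + 1)) M a S)⁻¹ *ᵥ g)) ≤ Λ' k * Real.sqrt (nsq g))
    {Cl θ : ℝ} (hrate : ∀ k, ε k * Λ k * Λ' k ≤ Cl * θ ^ k) (k : ℕ) :
    ‖(regionDeltaLoc (lev L (k + 1)) M a S)⁻¹ * JpR L M (starP L M S) k
        - JpR L M (starP L M S) k * (regionDeltaLoc (lev L k) M a S)⁻¹‖ ≤ Cl * θ ^ k :=
  (opNorm_injected_le_of_pairing (regionDeltaLoc_isHermitian (lev L (k + 1)) M a S)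
    (opNorm_inv_regionDeltaLoc_le (lev L (k + 1)) M a a' S ha' hγ (hco (k + 1))).1
    (opNorm_inv_regionDeltaLoc_le (lev L k) M a a' S ha' hγ (hco k)).1
    (JpR L M (starP L M S) k) (hε k) (hΛ k) (hΛ' k) (hP k) (hR k) (hR' k)).trans (hrate k)

/-- **`hinjK` ON ANY REGION WITH W1, FROM THE FOUR LEAVES AT RATE `θ`** (`0 < a′`, `0 < γ`, `0 ≤ θ`, `0 ≤ Cb`): the owner's `hinjK_of_local` with the
box theorem W1 replaced by a displayed level-uniform coercivity constant `γ` of `Δ_a^{(k)}(Ω₀)`. [folklore] -/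
theorem hinjK_of_local_of_coercive (ha' : 0 < a') {γ : ℝ} (hγ : 0 < γ) (hco : ∀ k, Coercive (regionDeltaA (lev L k) M a a' S) γ)
    {θ Cl Cb Cbt Ck : ℝ} (hθ : 0 ≤ θ) (hCb : 0 ≤ Cb)
    (hloc : ∀ k, ‖(regionDeltaLoc (lev L (k + 1)) M a S)⁻¹ * JpR L M (starP L M S) k
        - JpR L M (starP L M S) k * (regionDeltaLoc (lev L k) M a S)⁻¹‖ ≤ Cl * θ ^ k)
    (hB : ∀ k, ‖regionBh (lev L (k + 1)) M a' S - JpR L M (starP L M S) k * regionBh (lev L k) M a' S‖ ≤ Cb * θ ^ k)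
    (hBt : ∀ k, ‖(JpR L M (starP L M S) k)ᴴ * regionBh (lev L (k + 1)) M a' S - regionBh (lev L k) M a' S‖ ≤ Cbt * θ ^ k)
    (hK : ∀ k, ‖(KcompR (lev L (k + 1)) M a' S)⁻¹ - (KcompR (lev L k) M a' S)⁻¹‖ ≤ Ck * θ ^ k) (k : ℕ) :
    ‖(regionDeltaA (lev L (k + 1)) M a a' S)⁻¹ * JpR L M (starP L M S) k
        - JpR L M (starP L M S) k * (regionDeltaA (lev L k) M a a' S)⁻¹‖ ≤ C1reg d a' γ Cl Cb Cbt Ck * θ ^ k := by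
  have hθk : 0 ≤ θ ^ k := pow_nonneg hθ k
  have h := opNorm_injected_le_of_local (lev L k) (lev L (k + 1)) M a a' S ha' hγ (hco k) (hco (k + 1))
    (JpR L M (starP L M S) k) (opNorm_JpR_le L M (starP L M S) k) (mul_nonneg hCb hθk) (hloc k) (hB k) (hBt k) (hK k)
  refine h.trans (le_of_eq ?_)
  unfold C1reg gaugeErr
  ring

/-- **THE SAME WITH W1 AS ONE SLICE CONSTANT** (`SliceCoercive … c` at every level, `0 < c` — the shape of leaf-09-g9's holed/scattered ENDs and
of the owner's `sliceCoercive_lev_box`): `γ = gamStar d a′ c`. [folklore] -/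
theorem hinjK_of_local_of_slice (ha' : 0 < a') {c : ℝ} (hc : 0 < c)
    (hS : ∀ k, SliceCoercive (curlR (lev L k) M S) (gradR (lev L k) M S) (GOm (lev L k) M a' S) (QOm (lev L k) M S)
      (avgR (lev L k) M S) (a * ((lev L k : ℕ) : ℝ) ^ d) c)
    {θ Cl Cb Cbt Ck : ℝ} (hθ : 0 ≤ θ) (hCb : 0 ≤ Cb)
    (hloc : ∀ k, ‖(regionDeltaLoc (lev L (k + 1)) M a S)⁻¹ * JpR L M (starP L M S) k
        - JpR L M (starP L M S) k * (regionDeltaLoc (lev L k) M a S)⁻¹‖ ≤ Cl * θ ^ k)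
    (hB : ∀ k, ‖regionBh (lev L (k + 1)) M a' S - JpR L M (starP L M S) k * regionBh (lev L k) M a' S‖ ≤ Cb * θ ^ k)
    (hBt : ∀ k, ‖(JpR L M (starP L M S) k)ᴴ * regionBh (lev L (k + 1)) M a' S - regionBh (lev L k) M a' S‖ ≤ Cbt * θ ^ k)
    (hK : ∀ k, ‖(KcompR (lev L (k + 1)) M a' S)⁻¹ - (KcompR (lev L k) M a' S)⁻¹‖ ≤ Ck * θ ^ k) (k : ℕ) :
    ‖(regionDeltaA (lev L (k + 1)) M a a' S)⁻¹ * JpR L M (starP L M S) k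
        - JpR L M (starP L M S) k * (regionDeltaA (lev L k) M a a' S)⁻¹‖
      ≤ C1reg d a' (gamStar d a' c) Cl Cb Cbt Ck * θ ^ k :=
  hinjK_of_local_of_coercive L M S a a' ha' (gamStar_pos (d := d) a' hc)
    (fun j => coercive_regionDeltaA_of_slice (lev L j) M a a' S ha' hc (hS j)) hθ hCb hloc hB hBt hK k

end Summit.QuantumFields.BalabanUV.T4Continuum.RegionGaugeResolventTowerRegion

end
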